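import Literature.Analysis.UnboundedOperators.DiagonalOperator
import Literature.Analysis.InnerProduct.KyFanOrthonormal
import HarnessLib

/-!
# Ky Fan's two-level bound for diagonal operators in a Hilbert basis

Topic `Literature/Analysis/UnboundedOperators`; companion of `DiagonalOperator.lean` (the tree's model
of a self-adjoint operator with discrete spectrum: the maximal diagonal operator
`b.diagonalPMap m = ∑ m i ⟪b i, ·⟫ b i` of a Hilbert basis `b` with symbol `m`, whose ground-state
gap is characterised in `DiagonalOperatorProofs.lean`) and of
`Literature/Analysis/InnerProduct/KyFanOrthonormal.lean` (the abstract weight inequality). For a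
symbol `m` with lowest level `re (m i₀) ≤ m₂` and `m₂ ≤ re (m i)` for all `i ≠ i₀` (`m₂` = the
second lowest level, or any lower bound of the others), and every orthonormal pair `x₁, x₂` in the
domain of `diag(m)`,

  `re (m i₀) + m₂ ≤ re ⟪x₁, diag(m) x₁⟫ + re ⟪x₂, diag(m) x₂⟫`          (`kyFan_two_le_diagonalPMap`),

with equality for the basis pair `(b i₀, b i₁)` when `re (m i₁) = m₂` (`re_inner_diagonalPMap_basis`)
— Ky Fan's minimum principle for the sum of the two lowest eigenvalues (Ky Fan 1949, Thm. 1;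
Reed–Simon IV, §XIII.1, Thm. XIII.1–2), the form in which two-level spectral statements are phrased
variationally in the tree (`…QuantumManyBody.BoseGas.kyFanTwo`; the comparison operator
`𝒟 = Σ_p ε_p a_p† a_p` of [Boccato–Brennecke–Cenatiempo–Schlein 2019, §6] is such a diagonal operator
in the occupation basis, with `ν₁ = 0`, `ν₂ = ε_{2π}`).

* `hasSum_re_mul_norm_inner_sq_diagonalPMap` — the Rayleigh form in coordinates,
  `re ⟪x, diag(m) x⟫ = Σ_i re (m i) |⟪b i, x⟫|²` (as a `HasSum`), for `x ∈ dom diag(m)`;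
* `kyFan_two_le_diagonalPMap` — the bound above;
* `re_inner_diagonalPMap_basis` — `re ⟪b i, diag(m) (b i)⟫ = re (m i)` (attainment on basis pairs).

All declarations are deliberate dot-notation extensions in Mathlib's `namespace HilbertBasis`,
following `DiagonalOperator.lean`. No definitions, no named facts.

## References

* Ky Fan, Proc. Nat. Acad. Sci. USA 35 (1949) 652–655, Thm. 1. [folklore form]
* M. Reed, B. Simon, *Methods of Modern Mathematical Physics IV* (1978), §XIII.1 (p. 76: the
  Rayleigh quotient in an eigenbasis) and Thm. XIII.1–2. [ReedSimonIV1978]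
* C. Boccato, C. Brennecke, S. Cenatiempo, B. Schlein, Acta Math. 222 (2019), §6. [BoccatoEtAl2019Acta]
-/

noncomputable section

open RCLike Submodule
open scoped ComplexConjugate InnerProductSpace

namespace HilbertBasis

variable {ι 𝕜 H : Type*} [RCLike 𝕜] [NormedAddCommGroup H] [InnerProductSpace 𝕜 H]
variable (b : HilbertBasis ι 𝕜 H)

/-- (Dot-notation extension of Mathlib's `HilbertBasis`.) **The Rayleigh form of a diagonal operator
in coordinates**: for `x` in the domain of `diag(m)`,
`re ⟪x, diag(m) x⟫ = Σ_i re (m i) |⟪b i, x⟫|²`, as an unconditional sum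
(Reed–Simon IV, §XIII.1, p. 76: `(ψ, Aψ) = Σ λᵢ |αᵢ|²`). [cite: ReedSimonIV1978, §XIII.1 p. 76] -/
theorem hasSum_re_mul_norm_inner_sq_diagonalPMap (m : ι → 𝕜) (x : b.diagonalDomain m) :
    HasSum (fun i => re (m i) * ‖⟪b i, (x : H)⟫_𝕜‖ ^ 2)
      (re ⟪(x : H), b.diagonalPMap m x⟫_𝕜) := by
  have h := (lp.hasSum_inner (b.repr (x : H)) (b.repr (b.diagonalPMap m x))).mapL (reCLM : 𝕜 →L[ℝ] ℝ)
  rw [b.repr.inner_map_map] at h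
  have key : ∀ i, (reCLM : 𝕜 →L[ℝ] ℝ) ⟪b.repr (x : H) i, b.repr (b.diagonalPMap m x) i⟫_𝕜 =
      re (m i) * ‖⟪b i, (x : H)⟫_𝕜‖ ^ 2 := fun i => by
    rw [reCLM_apply, repr_diagonalPMap_apply, RCLike.inner_apply', b.repr_apply_apply, mul_left_comm,
      RCLike.conj_mul, ← RCLike.ofReal_pow, RCLike.re_mul_ofReal]
  simp only [key] at h
  exact h

/-- (Dot-notation extension of Mathlib's `HilbertBasis`.) The diagonal values:
`re ⟪b i, diag(m) (b i)⟫ = re (m i)`. [folklore] -/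
theorem re_inner_diagonalPMap_basis (m : ι → 𝕜) (i : ι) :
    re ⟪b i, b.diagonalPMap m ⟨b i, b.basis_mem_diagonalDomain m i⟩⟫_𝕜 = re (m i) := by
  rw [diagonalPMap_apply_basis, inner_smul_right, inner_self_eq_norm_sq_to_K, b.orthonormal.1 i]
  simp

/-- (Dot-notation extension of Mathlib's `HilbertBasis`.) **Ky Fan's two-level bound for a diagonal
operator.** Let `diag(m)` be the maximal diagonal operator of the Hilbert basis `b` with symbol `m`,
let `i₀` carry the lowest level, `re (m i₀) ≤ m₂`, and let `m₂ ≤ re (m i)` for all `i ≠ i₀`. Then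
for every orthonormal pair `x₁, x₂` in the domain,
`re (m i₀) + m₂ ≤ re ⟪x₁, diag(m) x₁⟫ + re ⟪x₂, diag(m) x₂⟫`: the sum of the two lowest levels is the
minimum of the form over orthonormal pairs (attained at `(b i₀, b i₁)` when `re (m i₁) = m₂`, by
`re_inner_diagonalPMap_basis`) — Ky Fan's principle / min–max for `k = 2` (Reed–Simon IV,
Thm. XIII.1). Proof: the Rayleigh form in coordinates and
`Literature.Analysis.InnerProduct.kyFan_two_le_hilbertBasis` (Bessel for the pair, Parseval).
[cite: ReedSimonIV1978, §XIII.1 Theorem XIII.1] -/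
theorem kyFan_two_le_diagonalPMap (m : ι → 𝕜) {i₀ : ι} {m₂ : ℝ} (h₀ : re (m i₀) ≤ m₂)
    (hm : ∀ i, i ≠ i₀ → m₂ ≤ re (m i)) (x₁ x₂ : b.diagonalDomain m)
    (h₁ : ‖(x₁ : H)‖ = 1) (h₂ : ‖(x₂ : H)‖ = 1) (h₁₂ : ⟪(x₁ : H), (x₂ : H)⟫_𝕜 = 0) :
    re (m i₀) + m₂ ≤
      re ⟪(x₁ : H), b.diagonalPMap m x₁⟫_𝕜 + re ⟪(x₂ : H), b.diagonalPMap m x₂⟫_𝕜 :=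
  Literature.Analysis.InnerProduct.kyFan_two_le_hilbertBasis b (μ := fun i => re (m i)) h₀ hm h₁ h₂
    h₁₂ (b.hasSum_re_mul_norm_inner_sq_diagonalPMap m x₁)
    (b.hasSum_re_mul_norm_inner_sq_diagonalPMap m x₂)

/-- (Dot-notation extension of Mathlib's `HilbertBasis`.) **Ky Fan form of a two-level gap.** Under
the hypotheses of `kyFan_two_le_diagonalPMap` with the ground level normalised to `m i₀ = 0`
(as in `HilbertBasis.hasGroundStateGap_diagonalPMap_iff`), every orthonormal pair in the domain has
`m₂ ≤ re ⟪x₁, diag(m) x₁⟫ + re ⟪x₂, diag(m) x₂⟫` — the "first excited level" lower bound in the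
variational (Ky Fan) phrasing used by the tree's two-level statements. [cite: ReedSimonIV1978, §XIII.1 Theorem XIII.1] -/
theorem le_re_inner_add_re_inner_diagonalPMap_of_apply_eq_zero (m : ι → 𝕜) {i₀ : ι} (hi₀ : m i₀ = 0)
    {m₂ : ℝ} (hm₂ : 0 ≤ m₂) (hm : ∀ i, i ≠ i₀ → m₂ ≤ re (m i)) (x₁ x₂ : b.diagonalDomain m)
    (h₁ : ‖(x₁ : H)‖ = 1) (h₂ : ‖(x₂ : H)‖ = 1) (h₁₂ : ⟪(x₁ : H), (x₂ : H)⟫_𝕜 = 0) :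
    m₂ ≤ re ⟪(x₁ : H), b.diagonalPMap m x₁⟫_𝕜 + re ⟪(x₂ : H), b.diagonalPMap m x₂⟫_𝕜 := by
  have h := b.kyFan_two_le_diagonalPMap m (i₀ := i₀) (m₂ := m₂) (by rw [hi₀, map_zero]; exact hm₂)
    hm x₁ x₂ h₁ h₂ h₁₂
  rwa [hi₀, map_zero, zero_add] at h

end HilbertBasis

end
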